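import Literature.Analysis.FluidPDE.HardSphereCollisionEnumeration
import Literature.Analysis.FluidPDE.EmpiricalCollisionMeasureMeasurable
import Summits.AtomisticToContinuum.HydrodynamicLimit.Theorems.OneFlightGossipEngineEquilibriumClampedCollisionalWindowLDDefs

/-!
# Coins are measurable, I: the coin count and the coin times
(crux `EquilibriumClampedCollisionalWindowLD`, stmt-AtomisticToContinuum-13733; line `coarse-coin-entropy-chain`;
stub `stub_compensatorDefectLD` (S5), layer L1 — registered sub-goals `compensatorDefect_coinCount_measurable`,
`compensatorDefect_coinTime_measurable`)

Support file (`--supports stmt-AtomisticToContinuum-13733`) in the vocabulary of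
`Theorems/OneFlightGossipEngineEquilibriumClampedCollisionalWindowLDDefs` (namespace
`Summit.AtomisticToContinuum.HydrodynamicLimit.Theorems.ClampedTransferCoin`). The coins of the line are the collisions
of the whole system in the kinetic window `(0, w]`, in time order: `coinCount σ τ Φ z` of them, at the times
`coinTime Φ z n = nthCollisionTime … (orbit Φ z) 0 n`, `n < coinCount σ τ Φ z`. Every use of the stub's filtration
(`∃ ℱ, …`) needs these objects to be MEASURABLE in the initial datum; this file proves it (no new definitions):

* an enumeration kit for a set of reals `S` finite on bounded intervals (`nthTimeAfter_spec`,
  `nthTimeAfter_mem_of_lt`, `ncard_inter_Ioc_nthTimeAfter`, `nthTimeAfter_strictMonoOn`, `image_nthTimeAfter_Iio`,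
  `inter_Ioo_nthTimeAfter_eq_image`, `sum_toFinset_eq_sum_range`, `sum_toFinset_Ioo_eq_sum_range`): the first
  `#(S ∩ (a, b])` enumerated times list `S ∩ (a, b]` increasingly (the enumeration theorems of
  `HardSphereCollisionEnumeration` are indexed by a collision time `s`; here they are re-indexed by the COUNT, which is
  what measurability arguments consume);
* along the flow, on the good set, with `#(0, b] :=` the number of collision times of the orbit in `(0, b]`
  (so that `coinCount σ τ Φ z = #(0, w]`, `coinCount_eq`): `coinTime_mem`, `ncard_Ioc_coinTime` (`#(0, coinTime n] = n + 1`),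
  `coinTime_lt_coinTime`, `ncard_Ioc_mono`, `lt_coinCount_and_le_iff` (`n < coinCount ∧ coinTime n ≤ s ↔ n < #(0, min s w]`),
  and the COIN DECOMPOSITION of collision sums `collisionSum_Ioc_eq_sum_range` / `collisionSum_Ioo_coinTime_eq_sum_range`
  (`Σ_{collisions in (0, b]} F = Σ_{n < #(0, b]} Σ_{ordered contact pairs at coin n} F(record)`);
* measurability: `measurable_indicator_ncard_Ioc` (via the velocity-jump engine
  `HardSphereFlow.measurable_indicator_collisionSum_Ioc` with `f ≡ 1` and `card_contactPairs_eq_two`),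
  `measurableSet_lt_ncard_Ioc` / `measurableSet_coinGuard` (`{z ∈ good | n < #(0, b]}`), and the two registered sub-goals
  `compensatorDefect_coinCount_measurable`, `compensatorDefect_coinTime_measurable` (the latter by the
  `measurable_of_Iic` characterisation through `lt_coinCount_and_le_iff`).

Hypothesis `0 < σ < 1/2` in the measurability part: then `ε_N = hsDiameter σ N ≤ σ < 1/2` (`hsDiameter_le`) and the
torus geometry is hard-sphere regular (`Torus.isHardSphereRegular_geometry`) and measurable (`Torus.isMeasurable_geometry`).
-/

noncomputable section

open MeasureTheory ProbabilityTheory Set Filter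
open scoped ENNReal BigOperators
open Literature.Analysis.FluidPDE Literature.MathematicalPhysics.KineticTheory
open Literature.Analysis.FunctionSpaces (Torus.partialDeriv Torus.IsSmooth)

namespace Summit.AtomisticToContinuum.HydrodynamicLimit.Theorems.ClampedTransferCoin

/-! ## Enumeration of a locally finite set of reals, indexed by the count -/

section Enumeration

variable {S : Set ℝ}

/-- **The first `#(S ∩ (a, b])` enumerated times.** For `S` finite on bounded intervals and
`n < #(S ∩ (a, b])`: the `n`-th enumerated time after `a` lies in `S ∩ (a, b]`, exactly `n + 1` elements of `S` lie
in `(a, nthTimeAfter S a n]`, and it exceeds all the previously enumerated times. -/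
theorem nthTimeAfter_spec (hfin : ∀ a b, (S ∩ Ioc a b).Finite) {a b : ℝ} {n : ℕ}
    (hn : n < (S ∩ Ioc a b).ncard) :
    nthTimeAfter S a n ∈ S ∩ Ioc a b ∧ (S ∩ Ioc a (nthTimeAfter S a n)).ncard = n + 1 ∧
      ∀ k < n, nthTimeAfter S a k < nthTimeAfter S a n := by
  induction n with
  | zero =>
    obtain ⟨v, hvS, hav, hvb⟩ := Set.nonempty_of_ncard_ne_zero (Nat.pos_iff_ne_zero.1 hn)
    have hl := isLeast_nthTimeAfter_zero (hfin a) ⟨v, hvS, hav⟩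
    have hset : S ∩ Ioc a (nthTimeAfter S a 0) = {nthTimeAfter S a 0} := by
      ext u
      refine ⟨fun hu => le_antisymm hu.2.2 (hl.2 ⟨hu.1, hu.2.1⟩), fun hu => ?_⟩
      rw [mem_singleton_iff.1 hu]
      exact ⟨hl.1.1, hl.1.2, le_rfl⟩
    refine ⟨⟨hl.1.1, hl.1.2, (hl.2 ⟨hvS, hav⟩).trans hvb⟩, by rw [hset, ncard_singleton],
      fun k hk => absurd hk (Nat.not_lt_zero k)⟩
  | succ n ih =>
    obtain ⟨⟨-, hat, -⟩, hcard, hmono⟩ := ih (n.lt_succ_self.trans hn)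
    have hlt : (S ∩ Ioc a (nthTimeAfter S a n)).ncard < (S ∩ Ioc a b).ncard := by
      rw [hcard]; exact hn
    obtain ⟨v, hv, hvnot⟩ := exists_mem_notMem_of_ncard_lt_ncard hlt (hfin a _)
    have htv : nthTimeAfter S a n < v := by
      by_contra h
      exact hvnot ⟨hv.1, hv.2.1, not_lt.1 h⟩
    have hl := isLeast_nthTimeAfter_succ hfin (a := a) (n := n) ⟨v, hv.1, htv⟩
    have hset : S ∩ Ioc a (nthTimeAfter S a (n + 1)) =
        insert (nthTimeAfter S a (n + 1)) (S ∩ Ioc a (nthTimeAfter S a n)) := by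
      ext u
      refine ⟨fun hu => ?_, fun hu => ?_⟩
      · by_cases hut : u ≤ nthTimeAfter S a n
        · exact Or.inr ⟨hu.1, hu.2.1, hut⟩
        · refine Or.inl (le_antisymm hu.2.2 (not_lt.1 fun hlt' => ?_))
          exact not_mem_of_mem_Ioo_nthTimeAfter_succ hfin ⟨not_le.1 hut, hlt'⟩ hu.1
      · rcases hu with rfl | hu
        · exact ⟨hl.1.1, hat.trans hl.1.2, le_rfl⟩
        · exact ⟨hu.1, hu.2.1, hu.2.2.trans hl.1.2.le⟩
    refine ⟨⟨hl.1.1, hat.trans hl.1.2, (hl.2 ⟨hv.1, htv⟩).trans hv.2.2⟩, ?_, fun k hk => ?_⟩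
    · rw [hset, ncard_insert_of_notMem (fun h => (not_le.2 hl.1.2) h.2.2) (hfin a _), hcard]
    · rcases (Nat.lt_succ_iff.1 hk).lt_or_eq with hk' | rfl
      · exact (hmono k hk').trans hl.1.2
      · exact hl.1.2

/-- For `n < #(S ∩ (a, b])` the `n`-th enumerated time after `a` is an element of `S ∩ (a, b]`. -/
theorem nthTimeAfter_mem_of_lt (hfin : ∀ a b, (S ∩ Ioc a b).Finite) {a b : ℝ} {n : ℕ}
    (hn : n < (S ∩ Ioc a b).ncard) : nthTimeAfter S a n ∈ S ∩ Ioc a b :=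
  (nthTimeAfter_spec hfin hn).1

/-- For `n < #(S ∩ (a, b])`, exactly `n + 1` elements of `S` lie in `(a, nthTimeAfter S a n]`. -/
theorem ncard_inter_Ioc_nthTimeAfter (hfin : ∀ a b, (S ∩ Ioc a b).Finite) {a b : ℝ} {n : ℕ}
    (hn : n < (S ∩ Ioc a b).ncard) : (S ∩ Ioc a (nthTimeAfter S a n)).ncard = n + 1 :=
  (nthTimeAfter_spec hfin hn).2.1

/-- The enumeration is strictly increasing on the indices `< #(S ∩ (a, b])`. -/
theorem nthTimeAfter_strictMonoOn (hfin : ∀ a b, (S ∩ Ioc a b).Finite) (a b : ℝ) :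
    StrictMonoOn (nthTimeAfter S a) (Iio (S ∩ Ioc a b).ncard) :=
  fun _ _ _ hn hkn => (nthTimeAfter_spec hfin hn).2.2 _ hkn

/-- **The first `#(S ∩ (a, b])` enumerated times list `S ∩ (a, b]`.** -/
theorem image_nthTimeAfter_Iio (hfin : ∀ a b, (S ∩ Ioc a b).Finite) (a b : ℝ) :
    nthTimeAfter S a '' Iio (S ∩ Ioc a b).ncard = S ∩ Ioc a b := by
  refine Set.eq_of_subset_of_ncard_le ?_ ?_ (hfin a b)
  · rintro _ ⟨n, hn, rfl⟩
    exact nthTimeAfter_mem_of_lt hfin hn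
  · rw [(nthTimeAfter_strictMonoOn hfin a b).injOn.ncard_image, ← Finset.coe_range,
      Set.ncard_coe_finset, Finset.card_range]

/-- The elements of `S` STRICTLY before the `n`-th enumerated time (for `n < #(S ∩ (a, b])`) are the enumerated
times of index `< n`. -/
theorem inter_Ioo_nthTimeAfter_eq_image (hfin : ∀ a b, (S ∩ Ioc a b).Finite) {a b : ℝ} {n : ℕ}
    (hn : n < (S ∩ Ioc a b).ncard) : S ∩ Ioo a (nthTimeAfter S a n) = nthTimeAfter S a '' Iio n := by
  have hmono := nthTimeAfter_strictMonoOn hfin a b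
  ext u
  refine ⟨fun hu => ?_, ?_⟩
  · have hub : u ∈ S ∩ Ioc a b :=
      ⟨hu.1, hu.2.1, (hu.2.2.trans_le (nthTimeAfter_mem_of_lt hfin hn).2.2).le⟩
    rw [← image_nthTimeAfter_Iio hfin a b] at hub
    obtain ⟨k, hk, rfl⟩ := hub
    refine ⟨k, Set.mem_Iio.2 (not_le.1 fun hnk => ?_), rfl⟩
    exact (not_lt.2 (hmono.monotoneOn hn hk hnk)) hu.2.2
  · rintro ⟨k, hk, rfl⟩
    have hkC : k ∈ Iio (S ∩ Ioc a b).ncard := lt_trans hk hn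
    exact ⟨(nthTimeAfter_mem_of_lt hfin hkC).1, (nthTimeAfter_mem_of_lt hfin hkC).2.1, hmono hkC hn hk⟩

/-- Finite-sum form: a sum over `S ∩ (a, b]` is the sum over the first `#(S ∩ (a, b])` enumerated times. -/
theorem sum_toFinset_eq_sum_range {M : Type*} [AddCommMonoid M] (hfin : ∀ a b, (S ∩ Ioc a b).Finite)
    {a b : ℝ} (hf : (S ∩ Ioc a b).Finite) (g : ℝ → M) :
    ∑ t ∈ hf.toFinset, g t = ∑ n ∈ Finset.range (S ∩ Ioc a b).ncard, g (nthTimeAfter S a n) := by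
  have hinj : Set.InjOn (nthTimeAfter S a) ↑(Finset.range (S ∩ Ioc a b).ncard) := by
    rw [Finset.coe_range]; exact (nthTimeAfter_strictMonoOn hfin a b).injOn
  rw [← Finset.sum_image hinj]
  refine Finset.sum_congr ?_ fun _ _ => rfl
  rw [← Finset.coe_inj, Set.Finite.coe_toFinset, Finset.coe_image, Finset.coe_range,
    image_nthTimeAfter_Iio hfin a b]

/-- The same over the open window `S ∩ (a, nthTimeAfter S a n)`: the sum over the enumerated times of index `< n`. -/
theorem sum_toFinset_Ioo_eq_sum_range {M : Type*} [AddCommMonoid M] (hfin : ∀ a b, (S ∩ Ioc a b).Finite)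
    {a b : ℝ} {n : ℕ} (hn : n < (S ∩ Ioc a b).ncard) (hf : (S ∩ Ioo a (nthTimeAfter S a n)).Finite)
    (g : ℝ → M) : ∑ t ∈ hf.toFinset, g t = ∑ k ∈ Finset.range n, g (nthTimeAfter S a k) := by
  have hinj : Set.InjOn (nthTimeAfter S a) ↑(Finset.range n) := by
    rw [Finset.coe_range]
    exact (nthTimeAfter_strictMonoOn hfin a b).injOn.mono fun k hk => lt_trans hk hn
  rw [← Finset.sum_image hinj]
  refine Finset.sum_congr ?_ fun _ _ => rfl
  rw [← Finset.coe_inj, Set.Finite.coe_toFinset, Finset.coe_image, Finset.coe_range,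
    inter_Ioo_nthTimeAfter_eq_image hfin hn]

end Enumeration

/-! ## Along the flow: the count of coins up to a time, the coin times, the coin decomposition -/

section Flow

variable {σ : ℝ} {N : ℕ}

/-- `coinCount` is the count of collision times of the orbit in the window `(0, w]` (unfolding lemma). -/
theorem coinCount_eq (τ : ℝ) (Φ : Flow σ N) (z : Phase N) :
    coinCount σ τ Φ z =
      (collisionTimes (Torus.geometry (Fin 3)) (hsDiameter σ N) (orbit Φ z) ∩ Set.Ioc 0 (window τ N)).ncard :=
  rfl

/-- On the good set the collision times of the orbit are finite on bounded half-open intervals. -/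
theorem finite_collisionTimes_Ioc (Φ : Flow σ N) {z : Phase N} (hz : z ∈ Φ.good) (a b : ℝ) :
    (collisionTimes (Torus.geometry (Fin 3)) (hsDiameter σ N) (orbit Φ z) ∩ Set.Ioc a b).Finite :=
  Φ.finite_collisionTimes_inter hz Set.Ioc_subset_Icc_self

/-- For `n < #(0, b]` (good `z`) the `n`-th coin is a collision at a time in `(0, b]`. -/
theorem coinTime_mem (Φ : Flow σ N) {z : Phase N} (hz : z ∈ Φ.good) {b : ℝ} {n : ℕ}
    (hn : n < (collisionTimes (Torus.geometry (Fin 3)) (hsDiameter σ N) (orbit Φ z) ∩ Set.Ioc 0 b).ncard) :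
    coinTime Φ z n ∈ collisionTimes (Torus.geometry (Fin 3)) (hsDiameter σ N) (orbit Φ z) ∩ Set.Ioc 0 b :=
  nthTimeAfter_mem_of_lt (finite_collisionTimes_Ioc Φ hz) hn

/-- Exactly `n + 1` coins up to and including the `n`-th one: `#(0, coinTime n] = n + 1`. -/
theorem ncard_Ioc_coinTime (Φ : Flow σ N) {z : Phase N} (hz : z ∈ Φ.good) {b : ℝ} {n : ℕ}
    (hn : n < (collisionTimes (Torus.geometry (Fin 3)) (hsDiameter σ N) (orbit Φ z) ∩ Set.Ioc 0 b).ncard) :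
    (collisionTimes (Torus.geometry (Fin 3)) (hsDiameter σ N) (orbit Φ z) ∩ Set.Ioc 0 (coinTime Φ z n)).ncard =
      n + 1 :=
  ncard_inter_Ioc_nthTimeAfter (finite_collisionTimes_Ioc Φ hz) hn

/-- The coin times increase strictly (below the count). -/
theorem coinTime_lt_coinTime (Φ : Flow σ N) {z : Phase N} (hz : z ∈ Φ.good) {b : ℝ} {k n : ℕ} (hkn : k < n)
    (hn : n < (collisionTimes (Torus.geometry (Fin 3)) (hsDiameter σ N) (orbit Φ z) ∩ Set.Ioc 0 b).ncard) :
    coinTime Φ z k < coinTime Φ z n :=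
  nthTimeAfter_strictMonoOn (finite_collisionTimes_Ioc Φ hz) 0 b (lt_trans hkn hn) hn hkn

/-- The count of coins up to a time is monotone in the time. -/
theorem ncard_Ioc_mono (Φ : Flow σ N) {z : Phase N} (hz : z ∈ Φ.good) {b b' : ℝ} (hbb' : b ≤ b') :
    (collisionTimes (Torus.geometry (Fin 3)) (hsDiameter σ N) (orbit Φ z) ∩ Set.Ioc 0 b).ncard ≤
      (collisionTimes (Torus.geometry (Fin 3)) (hsDiameter σ N) (orbit Φ z) ∩ Set.Ioc 0 b').ncard :=
  Set.ncard_le_ncard (Set.inter_subset_inter_right _ (Set.Ioc_subset_Ioc_right hbb'))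
    (finite_collisionTimes_Ioc Φ hz 0 b')

/-- **The event `{coin n happened by time s}` through counts**: on the good set,
`n < coinCount ∧ coinTime n ≤ s ↔ n < #(0, min s w]`. -/
theorem lt_coinCount_and_le_iff (τ : ℝ) (Φ : Flow σ N) {z : Phase N} (hz : z ∈ Φ.good) (n : ℕ) (s : ℝ) :
    (n < coinCount σ τ Φ z ∧ coinTime Φ z n ≤ s) ↔ n < (collisionTimes (Torus.geometry (Fin 3))
      (hsDiameter σ N) (orbit Φ z) ∩ Set.Ioc 0 (min s (window τ N))).ncard := by
  rw [coinCount_eq]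
  constructor
  · rintro ⟨hn, hs⟩
    have hmem := coinTime_mem Φ hz hn
    calc n < n + 1 := n.lt_succ_self
      _ = _ := (ncard_Ioc_coinTime Φ hz hn).symm
      _ ≤ _ := ncard_Ioc_mono Φ hz (le_min hs hmem.2.2)
  · intro hn
    exact ⟨hn.trans_le (ncard_Ioc_mono Φ hz (min_le_right _ _)),
      (coinTime_mem Φ hz hn).2.2.trans (min_le_left _ _)⟩

/-- **Coin decomposition of a collision sum over `(0, b]`** (good `z`): the sum over the collisions in `(0, b]` is
the sum over the coins `n < #(0, b]` of the sums over the ordered contact pairs at coin `n`. -/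
theorem collisionSum_Ioc_eq_sum_range {M : Type*} [AddCommMonoid M] (Φ : Flow σ N) {z : Phase N}
    (hz : z ∈ Φ.good) (b : ℝ) (F : Rec N → M) :
    Φ.collisionSum (Set.Ioc 0 b) F z = ∑ n ∈ Finset.range
      (collisionTimes (Torus.geometry (Fin 3)) (hsDiameter σ N) (orbit Φ z) ∩ Set.Ioc 0 b).ncard,
      ∑ p ∈ contactPairs (Torus.geometry (Fin 3)) (hsDiameter σ N) (Φ.flow (coinTime Φ z n) z),
        F (HardSphereCollisionRecord.ofConfig (Torus.geometry (Fin 3)) (hsDiameter σ N)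
          (Φ.flow (coinTime Φ z n) z) (coinTime Φ z n) p.1 p.2) := by
  show Literature.Analysis.FluidPDE.collisionSum (Torus.geometry (Fin 3)) (hsDiameter σ N) (orbit Φ z)
    (Set.Ioc 0 b) F = _
  rw [collisionSum_eq_finset_sum (finite_collisionTimes_Ioc Φ hz 0 b)]
  exact sum_toFinset_eq_sum_range (finite_collisionTimes_Ioc Φ hz) _ _

/-- **Coin decomposition over the open window `(0, coinTime n)`** (good `z`, `n < #(0, b]`): the sum over the
collisions strictly before coin `n` is the sum over the coins of index `< n`. -/
theorem collisionSum_Ioo_coinTime_eq_sum_range {M : Type*} [AddCommMonoid M] (Φ : Flow σ N) {z : Phase N}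
    (hz : z ∈ Φ.good) {b : ℝ} {n : ℕ}
    (hn : n < (collisionTimes (Torus.geometry (Fin 3)) (hsDiameter σ N) (orbit Φ z) ∩ Set.Ioc 0 b).ncard)
    (F : Rec N → M) :
    Φ.collisionSum (Set.Ioo 0 (coinTime Φ z n)) F z = ∑ k ∈ Finset.range n,
      ∑ p ∈ contactPairs (Torus.geometry (Fin 3)) (hsDiameter σ N) (Φ.flow (coinTime Φ z k) z),
        F (HardSphereCollisionRecord.ofConfig (Torus.geometry (Fin 3)) (hsDiameter σ N)
          (Φ.flow (coinTime Φ z k) z) (coinTime Φ z k) p.1 p.2) := by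
  have hf : (collisionTimes (Torus.geometry (Fin 3)) (hsDiameter σ N) (orbit Φ z) ∩
      Set.Ioo 0 (coinTime Φ z n)).Finite :=
    Φ.finite_collisionTimes_inter hz (Set.Ioo_subset_Icc_self (a := 0) (b := coinTime Φ z n))
  show Literature.Analysis.FluidPDE.collisionSum (Torus.geometry (Fin 3)) (hsDiameter σ N) (orbit Φ z)
    (Set.Ioo 0 (coinTime Φ z n)) F = _
  rw [collisionSum_eq_finset_sum hf]
  exact sum_toFinset_Ioo_eq_sum_range (finite_collisionTimes_Ioc Φ hz) hn hf _

end Flow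

/-! ## Measurability of the count and of the coin times -/

section Measurability

variable {σ : ℝ} {N : ℕ}

/-- For `0 ≤ σ < 1/2` the torus geometry is hard-sphere regular at the diameter `ε_N ≤ σ`. -/
theorem regular_hsDiameter (hσ : 0 ≤ σ) (hσ2 : σ < 1 / 2) (N : ℕ) :
    (Torus.geometry (Fin 3)).IsHardSphereRegular (hsDiameter σ N) :=
  Torus.isHardSphereRegular_geometry ((hsDiameter_le hσ N).trans_lt (by rw [one_div] at hσ2; exact hσ2))

/-- On the good set the collision sum of `1` over `(0, b]` is twice the count (each collision has two ordered
contact pairs). -/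
theorem collisionSum_one_eq_two_mul_ncard (hσ : 0 ≤ σ) (hσ2 : σ < 1 / 2) (Φ : Flow σ N) {z : Phase N}
    (hz : z ∈ Φ.good) (b : ℝ) :
    Φ.collisionSum (Set.Ioc 0 b) (fun _ => (1 : ℝ)) z =
      2 * ((collisionTimes (Torus.geometry (Fin 3)) (hsDiameter σ N) (orbit Φ z) ∩ Set.Ioc 0 b).ncard : ℝ) := by
  have hfin := finite_collisionTimes_Ioc Φ hz 0 b
  show Literature.Analysis.FluidPDE.collisionSum (Torus.geometry (Fin 3)) (hsDiameter σ N) (orbit Φ z) (Set.Ioc 0 b)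
    (fun _ => (1 : ℝ)) = _
  rw [collisionSum_eq_finset_sum hfin, Set.ncard_eq_toFinset_card _ hfin,
    Finset.card_eq_sum_ones hfin.toFinset, Nat.cast_sum, Finset.mul_sum]
  refine Finset.sum_congr rfl fun t ht => ?_
  rw [Finset.sum_const, nsmul_eq_mul, mul_one]
  have h2 : (contactPairs (Torus.geometry (Fin 3)) (hsDiameter σ N) (orbit Φ z t)).card = 2 :=
    (Φ.isTrajectory z hz).card_contactPairs_eq_two (regular_hsDiameter hσ hσ2 N)
      ((Set.Finite.mem_toFinset hfin).1 ht).1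
  rw [h2]
  norm_num

/-- **The count of coins up to a fixed time is measurable in the datum** (extended by `0` off the good set). -/
theorem measurable_indicator_ncard_Ioc (hσ : 0 < σ) (hσ2 : σ < 1 / 2) (Φ : Flow σ N) (b : ℝ) :
    Measurable (Φ.good.indicator fun z =>
      ((collisionTimes (Torus.geometry (Fin 3)) (hsDiameter σ N) (orbit Φ z) ∩ Set.Ioc 0 b).ncard : ℝ)) := by
  have h := Φ.measurable_indicator_collisionSum_Ioc (regular_hsDiameter hσ.le hσ2 N)
    Torus.isMeasurable_geometry (f := fun _ => (1 : ℝ)) continuous_const measurable_const 0 b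
  have heq : (Φ.good.indicator fun z =>
      ((collisionTimes (Torus.geometry (Fin 3)) (hsDiameter σ N) (orbit Φ z) ∩ Set.Ioc 0 b).ncard : ℝ)) =
      fun z => 2⁻¹ * Φ.good.indicator (fun z => Φ.collisionSum (Set.Ioc 0 b) (fun _ => (1 : ℝ)) z) z := by
    funext z
    by_cases hz : z ∈ Φ.good
    · simp only [Set.indicator_of_mem hz, collisionSum_one_eq_two_mul_ncard hσ.le hσ2 Φ hz b]
      ring
    · simp only [Set.indicator_of_notMem hz, mul_zero]
  rw [heq]
  exact h.const_mul _

/-- The event `{z ∈ good | n < #(0, b]}` is measurable. -/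
theorem measurableSet_lt_ncard_Ioc (hσ : 0 < σ) (hσ2 : σ < 1 / 2) (Φ : Flow σ N) (b : ℝ) (n : ℕ) :
    MeasurableSet {z | z ∈ Φ.good ∧
      n < (collisionTimes (Torus.geometry (Fin 3)) (hsDiameter σ N) (orbit Φ z) ∩ Set.Ioc 0 b).ncard} := by
  have heq : {z | z ∈ Φ.good ∧
      n < (collisionTimes (Torus.geometry (Fin 3)) (hsDiameter σ N) (orbit Φ z) ∩ Set.Ioc 0 b).ncard} =
      {z | (n : ℝ) < Φ.good.indicator (fun z =>
        ((collisionTimes (Torus.geometry (Fin 3)) (hsDiameter σ N) (orbit Φ z) ∩ Set.Ioc 0 b).ncard : ℝ)) z} := by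
    ext z
    by_cases hz : z ∈ Φ.good
    · simp only [Set.mem_setOf_eq, Set.indicator_of_mem hz, Nat.cast_lt, hz, true_and]
    · simp only [Set.mem_setOf_eq, Set.indicator_of_notMem hz, hz, false_and, false_iff, not_lt]
      exact Nat.cast_nonneg n
  rw [heq]
  exact measurableSet_lt measurable_const (measurable_indicator_ncard_Ioc hσ hσ2 Φ b)

/-- The guard event `{z ∈ good | n < coinCount}` of the coin bookkeeping is measurable. -/
theorem measurableSet_coinGuard (hσ : 0 < σ) (hσ2 : σ < 1 / 2) (τ : ℝ) (Φ : Flow σ N) (n : ℕ) :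
    MeasurableSet {z : Phase N | z ∈ Φ.good ∧ n < coinCount σ τ Φ z} :=
  measurableSet_lt_ncard_Ioc hσ hσ2 Φ (window τ N) n

/-- **L1a · the coin count is measurable in the datum** (registered sub-goal of `stub_compensatorDefectLD`). -/
theorem compensatorDefect_coinCount_measurable {σ : ℝ} (hσ : 0 < σ) (hσ2 : σ < 1 / 2) (τ : ℝ) (N : ℕ)
    (Φ : Flow σ N) : Measurable (Φ.good.indicator fun z => (coinCount σ τ Φ z : ℝ)) :=
  measurable_indicator_ncard_Ioc hσ hσ2 Φ (window τ N)

/-- **L1b · the coin times are measurable in the datum** (guarded by the count and the good set; registered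
sub-goal of `stub_compensatorDefectLD`): the sublevel set `{coinTime n ≤ s}` is the count event `{n < #(0, min s w]}`. -/
theorem compensatorDefect_coinTime_measurable {σ : ℝ} (hσ : 0 < σ) (hσ2 : σ < 1 / 2) (τ : ℝ) (N : ℕ)
    (Φ : Flow σ N) (n : ℕ) :
    Measurable (Φ.good.indicator fun z => if n < coinCount σ τ Φ z then coinTime Φ z n else 0) := by
  refine measurable_of_Iic fun s => ?_
  have heq : (Φ.good.indicator fun z => if n < coinCount σ τ Φ z then coinTime Φ z n else 0) ⁻¹' Set.Iic s =
      {z | z ∈ Φ.good ∧ n < (collisionTimes (Torus.geometry (Fin 3)) (hsDiameter σ N) (orbit Φ z) ∩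
        Set.Ioc 0 (min s (window τ N))).ncard} ∪
        ({z | z ∈ Φ.good ∧ n < coinCount σ τ Φ z}ᶜ ∩ {_z | 0 ≤ s}) := by
    ext z
    simp only [Set.mem_preimage, Set.mem_Iic, Set.mem_union, Set.mem_setOf_eq, Set.mem_inter_iff,
      Set.mem_compl_iff]
    by_cases hz : z ∈ Φ.good
    · rw [Set.indicator_of_mem hz]
      by_cases hn : n < coinCount σ τ Φ z
      · rw [if_pos hn, ← lt_coinCount_and_le_iff τ Φ hz n s]
        simp only [hz, hn, true_and, not_true_eq_false, false_and, or_false]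
      · rw [if_neg hn]
        have hn' : ¬ n < (collisionTimes (Torus.geometry (Fin 3)) (hsDiameter σ N) (orbit Φ z) ∩
            Set.Ioc 0 (min s (window τ N))).ncard := fun h =>
          hn (h.trans_le (ncard_Ioc_mono Φ hz (min_le_right _ _)))
        simp only [hz, hn', hn, true_and, and_false, not_false_eq_true, false_or]
    · rw [Set.indicator_of_notMem hz]
      simp only [hz, false_and, not_false_eq_true, true_and, false_or]
  rw [heq]
  exact (measurableSet_lt_ncard_Ioc hσ hσ2 Φ _ n).union
    ((measurableSet_coinGuard hσ hσ2 τ Φ n).compl.inter (MeasurableSet.const _))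

end Measurability

end Summit.AtomisticToContinuum.HydrodynamicLimit.Theorems.ClampedTransferCoin

end
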